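import Mathlib
import Summits.NavierStokesRegularity.NavierStokesRegularity.Theorems.EulerZoomLiouvillePowerGaugeEulerLiouvilleKelvinPinchTransport
import Summits.NavierStokesRegularity.NavierStokesRegularity.Theorems.EulerZoomLiouvillePowerGaugeEulerLiouvilleSmallMomentTools
import Literature.Analysis.FluidPDE.ElgindiBlowup
import HarnessLib

/-!
# Crux `EulerZoomLiouville.PowerGaugeEulerLiouville` (stmt-NavierStokesRegularity-19832): KELVIN'S PINCH, part 2 — MASS, K2, K3 (plate t60-PINCH of nsreg-p2 ROUND-55)

Width/portrait piece for THE ONE STATEMENT `stub_selfSimilarC2Needle` (LEAD skeleton `Cruxes/PowerGaugeEulerLiouville/Lines/birth.lean`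
v112, ns-typeII-p2 g16), `--supports stmt-NavierStokesRegularity-19832 --as helper`.  Texts = nsreg-p2 g45's `r55/Sketch55.lean`
(sha16 556b38828be01d7e, namespace `NsregP2.R55.Pinch`) §K, VERBATIM with the two idioms UNFOLDED (this file stays definition-free):
`simFlow ρ V′ s := ODE.evolutionMap (fun _ => selfSimilarTransport (1/(2+ρ)) 0 V′) 0 s` and
`weightedEnergy ρ V := (∫⁻ y, ‖DV y‖ₑ² · ofReal (‖y‖^{ρ−1})).toReal` (`E_w`).

Setting as in part 1 (`…KelvinPinchTransport`): `C²` self-similar Euler profile `(V, P)`, `γ = 1/(2+ρ)`, centre `0`, `Ω = curl V`,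
cut-off similarity flow `Ψ_s`, backward time `s = −σ`.

CONTENTS (all PROVED, std axioms; proofs = Sketch55's, by nsreg-p2 g45; Sketch55's glue lemmas `backwardContractionBound_of_mass`,
`kelvinPinchBound_of`, `kelvinPinchBound_of_mass` are inlined into the proofs of K2 / K3 below):
* **MASS** `backwardVorticityMassBound (hρ1 : ρ < 1) V` — the vorticity MASS of the backward image of any label set decays like
  `e^{−3γσ/2}`: `∫_{Ψ_{−σ}T} ‖Ω‖ ≤ 4 e^{−3σ/(2(2+ρ))} √(vol T) √(R^{1−ρ}E_w)` (backward Liouville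
  `BernoulliLandscape.volume_image_flow_eq_exp_of_stay`, Cauchy–Schwarz on `Ψ_{−σ}T ⊆ B_R`, `‖curl V‖ ≤ 4‖DV‖`,
  `SmallMoment.setLIntegral_ball_le_of_weightedEnergy`);
* **K2** `backwardContractionBound (hρ1 : ρ < 1) V` — `|∫_{Ψ_{−σ}T} ⟪Ω, ∇θ⟫| ≤ (same)` for `‖∇θ‖ ≤ 1`;
* **K3** `kelvinPinchBound (hρ : −2 < ρ) (hρ1 : ρ < 1) V` — KELVIN'S PINCH
  `|∫_T ⟪Ω, ∇(θ∘Ψ_{−σ})⟫| ≤ 4·e^{−(ρ+3/2)σ/(2+ρ)}·√(vol T)·√(R^{1−ρ}E_w)` (= K1 ∘ K2);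
* exponent bookkeeping `pinch_rate`, `pinch_rate_lt_knot_rate`, `pinch_rate_lt_jet_transverse_rate`, `physical_excess_rate`,
  `pinch_rate_window` (`(ρ+3/2)γ ∈ (¾, ⅘]` on `0 < ρ ≤ ½`).
By-name check: `example {ρ} (hρ : -2 < ρ) (hρ1 : ρ < 1) (V) : NsregP2.R55.Pinch.KelvinPinchBound ρ V := KelvinPinch.kelvinPinchBound hρ hρ1 V`
(and likewise MASS / K2 against `BackwardVorticityMassBound` / `BackwardContractionBound`).

HONEST FRAMING: Lagrangian bookkeeping for HYPOTHETICAL profiles; K3 is a necessary-history law met by the LEAD's surviving scenario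
(R55 §7); nothing here bears on the crux E (19832, OPEN) or on NS regularity; «hard core evaded: NO».
[nsreg-p2 R55 §K t60-PINCH; cite: ConstantinIgnatovaVicol2026Putative, §3.4.1 eq. (3.22)–(3.24), §3.4.2; folklore]
-/

noncomputable section

set_option linter.dupNamespace false

open Filter Topology MeasureTheory Set Metric Function InnerProductSpace
open scoped RealInnerProductSpace ENNReal NNReal

namespace Summit.NavierStokesRegularity.NavierStokesRegularity.Theorems.PowerGaugeEulerLiouville.KelvinPinch

open Literature.Analysis Literature.Analysis.FluidPDE
open Summit.NavierStokesRegularity.NavierStokesRegularity.Theorems.PowerGaugeEulerLiouville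

/-- **MASS PROVED (guard `ρ < 1`): the vorticity mass of the backward image of any label set decays like `e^{−3γσ/2}`**
(text = `NsregP2.R55.Pinch.BackwardVorticityMassBound ρ V`, Sketch55 556b38828be01d7e, idioms unfolded).
Backward Liouville `vol(Ψ_{−σ}T) = e^{−3γσ} vol T` (`BernoulliLandscape.volume_image_flow_eq_exp_of_stay` applied to `A := Ψ_{−σ}T`,
`Φ_σ A = T`), Cauchy–Schwarz on `A ⊆ B_R`, `‖curl V‖ ≤ 4‖DV‖` (`Literature…norm_curl_le_four_mul`) and
`∫⁻_{B_R}‖DV‖² ≤ R^{1−ρ}·E_w` (`SmallMoment.setLIntegral_ball_le_of_weightedEnergy`):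
`∫_{Ψ_{−σ}T} ‖Ω‖ ≤ 4 e^{−3σ/(2(2+ρ))} √(vol T) √(R^{1−ρ}E_w)`.
[nsreg-p2 R55 §K MASS; folklore; cite: ConstantinIgnatovaVicol2026Putative, §3.4.1 eq. (3.22)] -/
theorem backwardVorticityMassBound {ρ : ℝ} (hρ1 : ρ < 1) (V : EuclideanSpace ℝ (Fin 3) → EuclideanSpace ℝ (Fin 3)) :
    ∀ P : EuclideanSpace ℝ (Fin 3) → ℝ, IsSelfSimilarEulerProfile (1 / (2 + ρ)) 0 V P →
    (∫⁻ y, ‖fderiv ℝ V y‖ₑ ^ 2 * ENNReal.ofReal (‖y‖ ^ (ρ - 1))) ≠ ⊤ →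
    ∀ (T : Set (EuclideanSpace ℝ (Fin 3))) (σ R : ℝ) (V' : EuclideanSpace ℝ (Fin 3) → EuclideanSpace ℝ (Fin 3))
      (K Rbig : ℝ),
      MeasurableSet T → 0 ≤ σ → 1 ≤ R → ContDiff ℝ 2 V' → (∀ y, ‖fderiv ℝ V' y‖ ≤ K) → R < Rbig →
      (∀ w ∈ ball (0 : EuclideanSpace ℝ (Fin 3)) Rbig, V' w = V w) →
      (∀ a ∈ T, ∀ σ' ∈ Icc 0 σ,
        ODE.evolutionMap (fun _ : ℝ => selfSimilarTransport (1 / (2 + ρ)) (0 : EuclideanSpace ℝ (Fin 3)) V') 0 (-σ') a ∈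
          ball (0 : EuclideanSpace ℝ (Fin 3)) R) →
      ∫ y in ODE.evolutionMap (fun _ : ℝ => selfSimilarTransport (1 / (2 + ρ)) (0 : EuclideanSpace ℝ (Fin 3)) V') 0 (-σ) '' T,
          ‖curl V y‖ ≤
        4 * Real.exp (-(3 / (2 * (2 + ρ)) * σ)) * Real.sqrt (volume T).toReal *
          Real.sqrt (R ^ (1 - ρ) * (∫⁻ y, ‖fderiv ℝ V y‖ₑ ^ 2 * ENNReal.ofReal (‖y‖ ^ (ρ - 1))).toReal) := by
  intro P hP hE T σ R V' K Rbig hT hσ hR hV' hK hRbig hVeq hhist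
  set Ew := ∫⁻ y, ‖fderiv ℝ V y‖ₑ ^ 2 * ENNReal.ofReal (‖y‖ ^ (ρ - 1)) with hEw
  set γ : ℝ := 1 / (2 + ρ) with hγ
  set Φ := ODE.evolutionMap (fun _ : ℝ => selfSimilarTransport γ (0 : EuclideanSpace ℝ (Fin 3)) V') 0 with hΦ
  set A : Set (EuclideanSpace ℝ (Fin 3)) := Φ (-σ) '' T with hA
  have hR0 : 0 < R := by linarith
  have hV'1 : ContDiff ℝ 1 V' := hV'.of_le (by norm_num)
  -- the cut-off is divergence free on `‖z‖ ≤ R`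
  have hdiv : ∀ z : EuclideanSpace ℝ (Fin 3), ‖z‖ ≤ R → VectorCalculus.divergence V' z = 0 := by
    intro z hz
    have hzb : z ∈ ball (0 : EuclideanSpace ℝ (Fin 3)) Rbig := mem_ball_zero_iff.2 (lt_of_le_of_lt hz hRbig)
    have hfd : fderiv ℝ V' z = fderiv ℝ V z := NeedleClock.fderiv_eq_of_agree_ball hVeq hzb
    have h := hP.divFree z
    simp only [VectorCalculus.divergence] at h ⊢
    rw [hfd]; exact h
  have hflow_add : ∀ (s s' : ℝ) (y : EuclideanSpace ℝ (Fin 3)), Φ (s + s') y = Φ s (Φ s' y) :=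
    fun s s' y => C2.Kelvin.flow_add (γ := γ) hV'1 hK s s' y
  have hΦinv : ∀ y, Φ σ (Φ (-σ) y) = y := by
    intro y
    have h1 := hflow_add σ (-σ) y
    rw [add_neg_cancel] at h1
    rw [← h1]; exact ODE.evolutionMap_self _ 0 y
  have hΦinv' : ∀ z, Φ (-σ) (Φ σ z) = z := by
    intro z
    have h1 := hflow_add (-σ) σ z
    rw [neg_add_cancel] at h1
    rw [← h1]; exact ODE.evolutionMap_self _ 0 z
  -- `A = Φ_σ⁻¹ T` is measurable, lies in `B_R`, its forward orbits stay in `B̄_R` on `[0, σ]`, and `Φ_σ A = T`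
  have hAeq : A = Φ σ ⁻¹' T := by
    ext z
    constructor
    · rintro ⟨y, hy, rfl⟩; show Φ σ (Φ (-σ) y) ∈ T; rw [hΦinv y]; exact hy
    · intro hz; exact ⟨Φ σ z, hz, hΦinv' z⟩
  have hAm : MeasurableSet A := by
    rw [hAeq]; exact (C2.Kelvin.contDiff_flow (γ := γ) hV' hK σ).continuous.measurable hT
  have hAsub : A ⊆ ball (0 : EuclideanSpace ℝ (Fin 3)) R := by
    rintro _ ⟨a, ha, rfl⟩; exact hhist a ha σ ⟨hσ, le_rfl⟩
  have hstayA : ∀ z ∈ A, ∀ s ∈ Icc 0 σ, ‖Φ s z‖ ≤ R := by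
    rintro _ ⟨a, ha, rfl⟩ s hs
    have h1 : Φ s (Φ (-σ) a) = Φ (-(σ - s)) a := by
      rw [← hflow_add]; congr 1; ring
    rw [h1]
    exact (mem_ball_zero_iff.1 (hhist a ha (σ - s) ⟨by linarith [hs.2], by linarith [hs.1]⟩)).le
  have himage : Φ σ '' A = T := by
    ext y
    constructor
    · rintro ⟨_, ⟨a, ha, rfl⟩, rfl⟩; rw [hΦinv a]; exact ha
    · intro hy; exact ⟨Φ (-σ) y, ⟨y, hy, rfl⟩, hΦinv y⟩
  have hTsub : T ⊆ ball (0 : EuclideanSpace ℝ (Fin 3)) R := by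
    intro a ha
    have h := hhist a ha 0 ⟨le_rfl, hσ⟩
    rwa [neg_zero, show Φ 0 a = a from ODE.evolutionMap_self _ 0 a] at h
  have hTfin : volume T ≠ ⊤ := (lt_of_le_of_lt (measure_mono hTsub) measure_ball_lt_top).ne
  -- backward Liouville: `vol A = e^{−3γσ} vol T`
  have hvolT : volume T = ENNReal.ofReal (Real.exp (3 * γ * σ)) * volume A := by
    rw [← himage]
    exact BernoulliLandscape.volume_image_flow_eq_exp_of_stay (γ := γ) hV' hK hσ hdiv hAm hstayA
  have hvolA : volume A = ENNReal.ofReal (Real.exp (-(3 * γ * σ))) * volume T := by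
    rw [hvolT, ← mul_assoc, ← ENNReal.ofReal_mul (Real.exp_nonneg _), ← Real.exp_add, neg_add_cancel,
      Real.exp_zero, ENNReal.ofReal_one, one_mul]
  -- Cauchy–Schwarz on `A`
  have hcurlc : Continuous (curl V) := (differentiable_curl_of_contDiff hP.contDiff_velocity).continuous
  have hmeas : AEMeasurable (fun z => ‖curl V z‖ₑ) (volume.restrict A) := hcurlc.measurable.enorm.aemeasurable
  have hCS : ∫⁻ z in A, ‖curl V z‖ₑ ≤ volume A ^ (1 / 2 : ℝ) * (∫⁻ z in A, ‖curl V z‖ₑ ^ 2) ^ (1 / 2 : ℝ) := by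
    have h := ENNReal.lintegral_mul_le_Lp_mul_Lq (volume.restrict A) Real.HolderConjugate.two_two
      (f := fun _ => (1 : ℝ≥0∞)) aemeasurable_const hmeas
    have e2 : ∀ x : ℝ≥0∞, x ^ (2 : ℝ) = x ^ 2 := fun x => by exact_mod_cast ENNReal.rpow_natCast x 2
    simp only [Pi.mul_apply, one_mul, lintegral_const, Measure.restrict_apply_univ, e2, one_pow] at h
    exact h
  -- enstrophy on `A` from the E-budget: `∫⁻_A ‖curl V‖² ≤ 16 R^{1−ρ} E_w`
  have hball := SmallMoment.setLIntegral_ball_le_of_weightedEnergy hρ1 V hR0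
  have hens : ∫⁻ z in A, ‖curl V z‖ₑ ^ 2 ≤ 16 * (ENNReal.ofReal (R ^ (1 - ρ)) * Ew) := by
    calc ∫⁻ z in A, ‖curl V z‖ₑ ^ 2 ≤ ∫⁻ z in ball (0 : EuclideanSpace ℝ (Fin 3)) R, ‖curl V z‖ₑ ^ 2 :=
          lintegral_mono_set hAsub
      _ ≤ ∫⁻ z in ball (0 : EuclideanSpace ℝ (Fin 3)) R, 16 * ‖fderiv ℝ V z‖ₑ ^ 2 := by
          refine lintegral_mono fun z => ?_
          have h4 := norm_curl_le_four_mul V z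
          calc ‖curl V z‖ₑ ^ 2 = ENNReal.ofReal (‖curl V z‖ ^ 2) := by
                rw [← ofReal_norm, ENNReal.ofReal_pow (norm_nonneg _)]
            _ ≤ ENNReal.ofReal ((4 * ‖fderiv ℝ V z‖) ^ 2) :=
                ENNReal.ofReal_le_ofReal (pow_le_pow_left₀ (norm_nonneg _) h4 2)
            _ = 16 * ‖fderiv ℝ V z‖ₑ ^ 2 := by
                rw [mul_pow, ENNReal.ofReal_mul (by norm_num), ENNReal.ofReal_pow (norm_nonneg _), ofReal_norm]
                norm_num
      _ = 16 * ∫⁻ z in ball (0 : EuclideanSpace ℝ (Fin 3)) R, ‖fderiv ℝ V z‖ₑ ^ 2 := lintegral_const_mul' _ _ (by norm_num)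
      _ ≤ 16 * (ENNReal.ofReal (R ^ (1 - ρ)) * Ew) := by gcongr
  -- combine in `ℝ≥0∞`
  have hmain : ∫⁻ z in A, ‖curl V z‖ₑ ≤
      (ENNReal.ofReal (Real.exp (-(3 * γ * σ))) * volume T) ^ (1 / 2 : ℝ) *
        (16 * (ENNReal.ofReal (R ^ (1 - ρ)) * Ew)) ^ (1 / 2 : ℝ) := by
    calc ∫⁻ z in A, ‖curl V z‖ₑ ≤ volume A ^ (1 / 2 : ℝ) * (∫⁻ z in A, ‖curl V z‖ₑ ^ 2) ^ (1 / 2 : ℝ) := hCS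
      _ ≤ _ := by rw [hvolA]; gcongr
  -- pass to real numbers
  have hfin1 : ENNReal.ofReal (Real.exp (-(3 * γ * σ))) * volume T ≠ ⊤ := ENNReal.mul_ne_top ENNReal.ofReal_ne_top hTfin
  have hfin2 : 16 * (ENNReal.ofReal (R ^ (1 - ρ)) * Ew) ≠ ⊤ :=
    ENNReal.mul_ne_top (by norm_num) (ENNReal.mul_ne_top ENNReal.ofReal_ne_top hE)
  have hrhs : (ENNReal.ofReal (Real.exp (-(3 * γ * σ))) * volume T) ^ (1 / 2 : ℝ) *
      (16 * (ENNReal.ofReal (R ^ (1 - ρ)) * Ew)) ^ (1 / 2 : ℝ) ≠ ⊤ :=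
    ENNReal.mul_ne_top (ENNReal.rpow_ne_top_of_nonneg (by norm_num) hfin1)
      (ENNReal.rpow_ne_top_of_nonneg (by norm_num) hfin2)
  have h1 := ENNReal.toReal_mono hrhs hmain
  rw [ENNReal.toReal_mul, ← ENNReal.toReal_rpow, ← ENNReal.toReal_rpow, ENNReal.toReal_mul, ENNReal.toReal_mul,
    ENNReal.toReal_mul, ENNReal.toReal_ofReal (Real.exp_nonneg _),
    ENNReal.toReal_ofReal (by positivity : (0 : ℝ) ≤ R ^ (1 - ρ)), ENNReal.toReal_ofNat] at h1
  rw [integral_norm_eq_lintegral_enorm hcurlc.aestronglyMeasurable]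
  refine h1.trans (le_of_eq ?_)
  rw [Real.mul_rpow (Real.exp_nonneg _) ENNReal.toReal_nonneg,
    Real.mul_rpow (by norm_num) (mul_nonneg (by positivity) ENNReal.toReal_nonneg),
    ← Real.sqrt_eq_rpow, ← Real.sqrt_eq_rpow, ← Real.sqrt_eq_rpow, ← Real.sqrt_eq_rpow]
  have hs : Real.sqrt (Real.exp (-(3 * γ * σ))) = Real.exp (-(3 / (2 * (2 + ρ)) * σ)) := by
    have e : Real.exp (-(3 * γ * σ)) = Real.exp (-(3 / (2 * (2 + ρ)) * σ)) ^ 2 := by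
      rw [sq, ← Real.exp_add]; congr 1; rw [hγ]; field_simp; ring
    rw [e, Real.sqrt_sq (Real.exp_nonneg _)]
  have h16 : Real.sqrt 16 = 4 := by
    rw [show (16 : ℝ) = 4 ^ 2 by norm_num, Real.sqrt_sq (by norm_num : (0 : ℝ) ≤ 4)]
  rw [hs, h16]; ring

/-- **K2 PROVED (guard `ρ < 1`): THE BACKWARD CONTRACTION BOUND** (text = `NsregP2.R55.Pinch.BackwardContractionBound ρ V`, Sketch55
556b38828be01d7e = Seed55 VERBATIM, idioms unfolded) — for `‖∇θ‖ ≤ 1`,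
`|∫_{Ψ_{−σ}T} ⟪Ω, ∇θ⟫| ≤ 4 e^{−3σ/(2(2+ρ))} √(vol T) √(R^{1−ρ}E_w)`: `|∫⟪Ω, ∇θ⟫| ≤ ∫‖Ω‖` (Sketch55 glue
`backwardContractionBound_of_mass`: `Ω` is continuous, the image set lies in `B_R`) and MASS.
[nsreg-p2 R55 §K K2; folklore; cite: ConstantinIgnatovaVicol2026Putative, §3.4.1 eq. (3.22)] -/
theorem backwardContractionBound {ρ : ℝ} (hρ1 : ρ < 1) (V : EuclideanSpace ℝ (Fin 3) → EuclideanSpace ℝ (Fin 3)) :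
    ∀ P : EuclideanSpace ℝ (Fin 3) → ℝ, IsSelfSimilarEulerProfile (1 / (2 + ρ)) 0 V P →
    (∫⁻ y, ‖fderiv ℝ V y‖ₑ ^ 2 * ENNReal.ofReal (‖y‖ ^ (ρ - 1))) ≠ ⊤ →
    ∀ (T : Set (EuclideanSpace ℝ (Fin 3))) (σ R : ℝ) (V' : EuclideanSpace ℝ (Fin 3) → EuclideanSpace ℝ (Fin 3))
      (K Rbig : ℝ) (θ : EuclideanSpace ℝ (Fin 3) → ℝ),
      MeasurableSet T → 0 ≤ σ → 1 ≤ R → ContDiff ℝ 2 V' → (∀ y, ‖fderiv ℝ V' y‖ ≤ K) → R < Rbig →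
      (∀ w ∈ ball (0 : EuclideanSpace ℝ (Fin 3)) Rbig, V' w = V w) →
      (∀ a ∈ T, ∀ σ' ∈ Icc 0 σ,
        ODE.evolutionMap (fun _ : ℝ => selfSimilarTransport (1 / (2 + ρ)) (0 : EuclideanSpace ℝ (Fin 3)) V') 0 (-σ') a ∈
          ball (0 : EuclideanSpace ℝ (Fin 3)) R) →
      ContDiff ℝ 1 θ → (∀ y, ‖gradient θ y‖ ≤ 1) →
      |∫ y in ODE.evolutionMap (fun _ : ℝ => selfSimilarTransport (1 / (2 + ρ)) (0 : EuclideanSpace ℝ (Fin 3)) V') 0 (-σ) '' T,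
          ⟪curl V y, gradient θ y⟫| ≤
        4 * Real.exp (-(3 / (2 * (2 + ρ)) * σ)) * Real.sqrt (volume T).toReal *
          Real.sqrt (R ^ (1 - ρ) * (∫⁻ y, ‖fderiv ℝ V y‖ₑ ^ 2 * ENNReal.ofReal (‖y‖ ^ (ρ - 1))).toReal) := by
  intro P hP hE T σ R V' K Rbig θ hT hσ hR hV' hK hRbig hVeq hhist _hθ hθ1
  have hmass := backwardVorticityMassBound hρ1 V P hP hE T σ R V' K Rbig hT hσ hR hV' hK hRbig hVeq hhist
  refine le_trans ?_ hmass
  rw [← Real.norm_eq_abs]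
  -- the image set lies in `B_R`, where the continuous `curl V` is integrable
  have hsub : ODE.evolutionMap (fun _ : ℝ => selfSimilarTransport (1 / (2 + ρ)) (0 : EuclideanSpace ℝ (Fin 3)) V') 0 (-σ) '' T ⊆
      closedBall (0 : EuclideanSpace ℝ (Fin 3)) R := by
    rintro _ ⟨a, ha, rfl⟩
    exact mem_closedBall_zero_iff.2 (mem_ball_zero_iff.1 (hhist a ha σ ⟨hσ, le_rfl⟩)).le
  have hcurl : Continuous (curl V) :=
    (differentiable_curl_of_contDiff hP.contDiff_velocity).continuous
  have hint : IntegrableOn (fun y => ‖curl V y‖)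
      (ODE.evolutionMap (fun _ : ℝ => selfSimilarTransport (1 / (2 + ρ)) (0 : EuclideanSpace ℝ (Fin 3)) V') 0 (-σ) '' T) :=
    (hcurl.norm.continuousOn.integrableOn_compact (isCompact_closedBall (0 : EuclideanSpace ℝ (Fin 3)) R)).mono_set hsub
  refine norm_integral_le_of_norm_le hint (ae_of_all _ fun y => ?_)
  calc ‖⟪curl V y, gradient θ y⟫‖ ≤ ‖curl V y‖ * ‖gradient θ y‖ := norm_inner_le_norm _ _
    _ ≤ ‖curl V y‖ * 1 := mul_le_mul_of_nonneg_left (hθ1 y) (norm_nonneg _)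
    _ = ‖curl V y‖ := mul_one _

/-- **K3 PROVED — KELVIN'S PINCH (guards `−2 < ρ < 1`)** (text = `NsregP2.R55.Pinch.KelvinPinchBound ρ V`, Sketch55 556b38828be01d7e =
Seed55 VERBATIM, idioms unfolded): for every measurable label set `T` with backward history in `B_R` (`1 ≤ R < Rbig`) up to `σ ≥ 0`
and every `C¹` observable with `‖∇θ‖ ≤ 1`,
`|∫_T ⟪curl V, ∇(θ∘Ψ_{−σ})⟫| ≤ 4·e^{−(ρ+3/2)σ/(2+ρ)}·√(vol T)·√(R^{1−ρ}E_w)` — K1 (`kelvinTransportIdentity`) ∘ K2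
(`backwardContractionBound`), rates `ρ/(2+ρ) + 3/(2(2+ρ)) = (ρ+3/2)/(2+ρ)` (Sketch55 glue `kelvinPinchBound_of`, inlined).
Read on flux tubes: today's flux × the ancestors' cap-separation decays at the pinch rate `(ρ+3/2)γ ∈ (¾, ⅘]` (`pinch_rate_window`).
[nsreg-p2 R55 §K K3; cite: ConstantinIgnatovaVicol2026Putative, §3.4.1 eq. (3.22)–(3.24), §3.4.2] -/
theorem kelvinPinchBound {ρ : ℝ} (hρ : -2 < ρ) (hρ1 : ρ < 1) (V : EuclideanSpace ℝ (Fin 3) → EuclideanSpace ℝ (Fin 3)) :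
    ∀ P : EuclideanSpace ℝ (Fin 3) → ℝ, IsSelfSimilarEulerProfile (1 / (2 + ρ)) 0 V P →
    (∫⁻ y, ‖fderiv ℝ V y‖ₑ ^ 2 * ENNReal.ofReal (‖y‖ ^ (ρ - 1))) ≠ ⊤ →
    ∀ (T : Set (EuclideanSpace ℝ (Fin 3))) (σ R : ℝ) (V' : EuclideanSpace ℝ (Fin 3) → EuclideanSpace ℝ (Fin 3))
      (K Rbig : ℝ) (θ : EuclideanSpace ℝ (Fin 3) → ℝ),
      MeasurableSet T → 0 ≤ σ → 1 ≤ R → ContDiff ℝ 2 V' → (∀ y, ‖fderiv ℝ V' y‖ ≤ K) → R < Rbig →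
      (∀ w ∈ ball (0 : EuclideanSpace ℝ (Fin 3)) Rbig, V' w = V w) →
      (∀ a ∈ T, ∀ σ' ∈ Icc 0 σ,
        ODE.evolutionMap (fun _ : ℝ => selfSimilarTransport (1 / (2 + ρ)) (0 : EuclideanSpace ℝ (Fin 3)) V') 0 (-σ') a ∈
          ball (0 : EuclideanSpace ℝ (Fin 3)) R) →
      ContDiff ℝ 1 θ → (∀ y, ‖gradient θ y‖ ≤ 1) →
      |∫ a in T, ⟪curl V a, gradient (fun b => θ
          (ODE.evolutionMap (fun _ : ℝ => selfSimilarTransport (1 / (2 + ρ)) (0 : EuclideanSpace ℝ (Fin 3)) V') 0 (-σ) b)) a⟫| ≤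
        4 * Real.exp (-((ρ + 3 / 2) / (2 + ρ) * σ)) * Real.sqrt (volume T).toReal *
          Real.sqrt (R ^ (1 - ρ) * (∫⁻ y, ‖fderiv ℝ V y‖ₑ ^ 2 * ENNReal.ofReal (‖y‖ ^ (ρ - 1))).toReal) := by
  intro P hP hE T σ R V' K Rbig θ hT hσ hR hV' hK hRbig hVeq hhist hθ hθ1
  have h2ρ : 2 + ρ ≠ 0 := (by linarith : (0 : ℝ) < 2 + ρ).ne'
  rw [kelvinTransportIdentity h2ρ V P hP T σ R V' K Rbig θ hT hσ (by linarith) hV' hK hRbig hVeq hhist hθ, abs_mul,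
    Real.abs_exp]
  have hb := backwardContractionBound hρ1 V P hP hE T σ R V' K Rbig θ hT hσ hR hV' hK hRbig hVeq hhist hθ hθ1
  calc Real.exp (-(ρ / (2 + ρ) * σ)) *
        |∫ y in ODE.evolutionMap (fun _ : ℝ => selfSimilarTransport (1 / (2 + ρ)) (0 : EuclideanSpace ℝ (Fin 3)) V') 0 (-σ) '' T,
          ⟪curl V y, gradient θ y⟫|
      ≤ Real.exp (-(ρ / (2 + ρ) * σ)) * (4 * Real.exp (-(3 / (2 * (2 + ρ)) * σ)) * Real.sqrt (volume T).toReal *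
          Real.sqrt (R ^ (1 - ρ) * (∫⁻ y, ‖fderiv ℝ V y‖ₑ ^ 2 * ENNReal.ofReal (‖y‖ ^ (ρ - 1))).toReal)) :=
        mul_le_mul_of_nonneg_left hb (Real.exp_nonneg _)
    _ = 4 * Real.exp (-((ρ + 3 / 2) / (2 + ρ) * σ)) * Real.sqrt (volume T).toReal *
          Real.sqrt (R ^ (1 - ρ) * (∫⁻ y, ‖fderiv ℝ V y‖ₑ ^ 2 * ENNReal.ofReal (‖y‖ ^ (ρ - 1))).toReal) := by
        have : Real.exp (-((ρ + 3 / 2) / (2 + ρ) * σ)) =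
            Real.exp (-(ρ / (2 + ρ) * σ)) * Real.exp (-(3 / (2 * (2 + ρ)) * σ)) := by
          rw [← Real.exp_add]; congr 1; rw [div_mul_eq_div_div]; ring
        rw [this]; ring

/-! ### Exponent bookkeeping (PROVED; `γ = 1/(2+ρ)`) -/

/-- The K3 rate: `ργ + 3γ/2 = (ρ + 3/2)γ`. [nsreg-p2 R55 §K EXP] -/
theorem pinch_rate {ρ : ℝ} (hρ : 2 + ρ ≠ 0) :
    ρ / (2 + ρ) + 3 / (2 * (2 + ρ)) = (ρ + 3 / 2) / (2 + ρ) := by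
  rw [div_add_div _ _ hρ (mul_ne_zero two_ne_zero hρ), div_eq_div_iff (mul_ne_zero hρ (mul_ne_zero two_ne_zero hρ)) hρ]
  ring

/-- The pinch rate is BELOW the knot's own axial backward contraction rate `1 + γ` (linearised profile at a `W`-zero):
`(ρ + 3/2)γ < 1 + γ` for every `ρ > −2` — consistency of K3 with the stagnation spectrum (`…NeedleStagnationSpectrum`);
room `1 + γ − (ρ+3/2)γ = 3γ/2` (= the MASS rate). [nsreg-p2 R55 §K EXP] -/
theorem pinch_rate_lt_knot_rate {ρ : ℝ} (hρ : -2 < ρ) :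
    (ρ + 3 / 2) / (2 + ρ) < 1 + 1 / (2 + ρ) := by
  have h2 : 0 < 2 + ρ := by linarith
  rw [div_lt_iff₀ h2, add_mul, one_div_mul_cancel h2.ne']
  linarith

/-- The pinch rate is BELOW the transverse backward contraction rate `γ + ½` of a free-fall jet (`div V = 0`, axial rate `γ − 1`)
iff `ρ < 1`: K3 does not strain straight jet segments either. [nsreg-p2 R55 §K EXP] -/
theorem pinch_rate_lt_jet_transverse_rate {ρ : ℝ} (hρ : -2 < ρ) (hρ1 : ρ < 1) :
    (ρ + 3 / 2) / (2 + ρ) < 1 / (2 + ρ) + 1 / 2 := by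
  have h2 : 0 < 2 + ρ := by linarith
  rw [div_lt_iff₀ h2, add_mul, one_div_mul_cancel h2.ne']
  nlinarith

/-- The physical excess over pure self-similar rescaling: `(ρ + 3/2)γ − γ = (ρ + ½)γ` (factor `(−τ)^{−γ(ρ+½)}`). [nsreg-p2 R55 §K EXP] -/
theorem physical_excess_rate {ρ : ℝ} (hρ : 2 + ρ ≠ 0) :
    (ρ + 3 / 2) / (2 + ρ) - 1 / (2 + ρ) = (ρ + 1 / 2) / (2 + ρ) := by
  field_simp; ring

/-- On the needle range `0 < ρ ≤ ½` the pinch rate lies in `(3/4, 4/5]`. [nsreg-p2 R55 §K EXP] -/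
theorem pinch_rate_window {ρ : ℝ} (hρ : 0 < ρ) (hρ1 : ρ ≤ 1 / 2) :
    3 / 4 < (ρ + 3 / 2) / (2 + ρ) ∧ (ρ + 3 / 2) / (2 + ρ) ≤ 4 / 5 := by
  have h2 : 0 < 2 + ρ := by linarith
  constructor
  · rw [lt_div_iff₀ h2]; linarith
  · rw [div_le_iff₀ h2]; linarith

end Summit.NavierStokesRegularity.NavierStokesRegularity.Theorems.PowerGaugeEulerLiouville.KelvinPinch

end
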